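import Mathlib
import Summits.NavierStokesRegularity.NavierStokesRegularity.Theorems.TaoLadderRungTwoBreakOneShiftWindowPairDataD
import HarnessLib

/-!
# The one-shift window system, XXXIII: THE JACOBIAN CLOSENESS `Bt + L·|x − x'|` OF A ROUGH AND THE CENTRE TERM LIST,
# the identity `Bt + L·prox = colVal (adRow prox)` and the sparse-product identity `Σ_j colVal row (e j) · g (e j) =
# Σ_{(c,r) ∈ row} r · g c` — the remaining real-side facts the pair-slope checker (part XXXIV) uses to build
# `StepSlopeData` (part XVI) from term data (cell harvest/h2-tao-ladder, seat p2; rung1/KERNEL-CHEAP-REPLAY-SPEC.md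
# §6 (iii)/(iv), §7 «CHECKER» (d); support for K1(1) = `NoSurvivingDSSOne`, stmt-NavierStokesRegularity-20205)

MODEL lattice ODEs only (Tao 2016 §4 normal form on Tao's shift set `S`); nothing here is a statement about
the Navier–Stokes equations; no item is closed; nothing numerical is certified. Generic in `ι` (numbered by
`e : ι ≃ Fin n`) and `κ`. Data model: parts XXX/XXXII.

* `abs_val_sub_le` — a matched factor pair: `|φt(x) − φc(x')| ≤ radR + Σ_k icn (e k) · |x_k − x'_k|`;
* **`abs_jacEntry_sub_le_Bt_L`** — `|jacEntry Tt x i j − jacEntry Tc x' i j| ≤ Btf row_i (e j) + Σ_k Lf row_i (e j) (e k) ·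
  |x_k − x'_k|` for ALL `x, x'` (the `hclose` of `exists_stepPairSlope`, with `Bt`, `L` read from the data);
* **`Bt_add_L_prox_eq_colVal_adRow`** — `Btf row (e j) + Σ_k Lf row (e j) (e k) · prox (e k) = colVal (adRow prox row) (e j)`;
* `fst_lt_of_mem_magRow` / `fst_lt_of_mem_adRow` — the sparse rows only carry valid column indices;
* **`sum_colVal_mul`** — `Σ_j colVal row (e j) · g (e j) = (row.map (r · g c)).sum` for rows with valid indices: the
  checker's sparse row-times-column products ARE the real matrix products of `StepSlopeData.fix`.
-/

-- the sub-problem namespace repeats the summit name by design (D-0017)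
set_option linter.dupNamespace false

namespace Summit.NavierStokesRegularity.NavierStokesRegularity.Theorems

namespace DSSOneShift

open Set Finset
open Summit.NavierStokesRegularity.NavierStokesRegularity.Theorems.TaylorModelCert
open Summit.NavierStokesRegularity.NavierStokesRegularity.Theorems.TaylorModelReadout
open Summit.NavierStokesRegularity.NavierStokesRegularity.Theorems.CertificateGlueOn

variable {ι : Type*} [Fintype ι] [DecidableEq ι] {κ : Type*} [Fintype κ] {n : ℕ} (e : ι ≃ Fin n)
  {Tc Tt : κ → BTerm ι}

/-! ### Unfolding `Btf`, `Lf` -/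

omit [Fintype ι] [DecidableEq ι] in
/-- `Btf` of a cons. [folklore] -/
theorem Btf_cons (d : RTermD) (dl : List RTermD) (j : ℕ) :
    Btf (d :: dl) j = (IntervalD.mag d.1).toReal * (d.2.1.icn j * d.2.2.radR + d.2.1.radR * d.2.2.icn j) + Btf dl j := by
  simp [Btf]

omit [Fintype ι] [DecidableEq ι] in
/-- `Lf` of a cons. [folklore] -/
theorem Lf_cons (d : RTermD) (dl : List RTermD) (j c : ℕ) :
    Lf (d :: dl) j c = (IntervalD.mag d.1).toReal * (d.2.1.icn j * d.2.2.icn c + d.2.1.icn c * d.2.2.icn j) + Lf dl j c := by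
  simp [Lf]

/-! ### Factor differences -/

omit [DecidableEq ι] in
/-- The indicator sum picks the coordinate. [folklore] -/
theorem sum_icn_coord (c : ℕ) {i : ι} (hi : (e i : ℕ) = c) (g : ι → ℝ) :
    ∑ k, (RFac.coord c).icn (e k) * g k = g i := by
  classical
  have : ∀ k, (RFac.coord c).icn (e k) * g k = if k = i then g i else 0 := by
    intro k
    simp only [RFac.icn]
    by_cases hk : k = i
    · subst hk; simp [hi]
    · rw [if_neg (fun h => hk (e.injective (Fin.ext (by rw [hi]; exact h.symm)))), if_neg hk, zero_mul]
  simp_rw [this]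
  simp

omit [DecidableEq ι] in
/-- An external factor has zero indicator sums. [folklore] -/
theorem sum_icn_ext (cen : IntervalD) (rad : Dyad) (g : ι → ℝ) : ∑ k, (RFac.ext cen rad).icn (e k) * g k = 0 := by
  simp [RFac.icn]

omit [DecidableEq ι] in
/-- **A matched factor pair is close**: `|φt(x) − φc(x')| ≤ radR + Σ_k icn (e k) |x_k − x'_k|`. [folklore] -/
theorem abs_val_sub_le {d : RFac} {φc φt : Factor ι} (h : FacOK e d φc φt) (x x' : ι → ℝ) :
    |φt.val x - φc.val x'| ≤ d.radR + ∑ k, d.icn (e k) * |x k - x' k| := by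
  cases d with
  | coord c =>
    obtain ⟨i, hi, rfl, rfl⟩ := h
    rw [sum_icn_coord e c hi]
    simp [Factor.val, RFac.radR]
  | ext cen rad =>
    obtain ⟨rc, rt, rfl, rfl, -, -, hdev⟩ := h
    rw [sum_icn_ext e]
    simpa [Factor.val, RFac.radR] using hdev

omit [Fintype ι] [DecidableEq ι] in
/-- Matched data have non-negative radii. [folklore] -/
theorem radR_nonneg_of_facOK {d : RFac} {φc φt : Factor ι} (h : FacOK e d φc φt) : 0 ≤ d.radR := by
  cases d with
  | coord c => simp [RFac.radR]
  | ext cen rad => obtain ⟨rc, rt, -, -, -, h0, -⟩ := h; simpa [RFac.radR] using h0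

/-! ### The Jacobian closeness -/

omit [Fintype κ] in
/-- List form of the closeness bound. [folklore] -/
theorem abs_closeList_le (x x' : ι → ℝ) (j : ι) :
    ∀ {dl : List RTermD} {kl : List κ}, List.Forall₂ (fun d k => TermOK e d (Tc k) (Tt k)) dl kl →
      |(kl.map fun k => (Tc k).coef * (((Tt k).fa.isCoord j * (Tt k).fb.val x + (Tt k).fa.val x * (Tt k).fb.isCoord j) -
        ((Tc k).fa.isCoord j * (Tc k).fb.val x' + (Tc k).fa.val x' * (Tc k).fb.isCoord j))).sum| ≤
        Btf dl (e j) + ∑ k, Lf dl (e j) (e k) * |x k - x' k|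
  | _, _, List.Forall₂.nil => by simp [Btf, Lf]
  | _, _, List.Forall₂.cons (a := d) (b := k) (l₁ := dl) (l₂ := kl) h hl => by
    have ih := abs_closeList_le x x' j hl
    obtain ⟨hq, -, hfa, hfb⟩ := h
    have hia := isCoord_eq_icn e hfa j
    have hib := isCoord_eq_icn e hfb j
    have hda := abs_val_sub_le e hfa x x'
    have hdb := abs_val_sub_le e hfb x x'
    have hqm : |(Tc k).coef| ≤ (IntervalD.mag d.1).toReal := IntervalD.abs_le_mag hq
    -- abbreviations
    set M := (IntervalD.mag d.1).toReal with hM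
    set A := d.2.1.icn (e j) with hA
    set B := d.2.2.icn (e j) with hB
    set Sa := ∑ c, d.2.1.icn (e c) * |x c - x' c| with hSa
    set Sb := ∑ c, d.2.2.icn (e c) * |x c - x' c| with hSb
    have hA0 : 0 ≤ A := icn_nonneg _ _
    have hB0 : 0 ≤ B := icn_nonneg _ _
    have hM0 : 0 ≤ M := (abs_nonneg _).trans hqm
    -- the single term
    have hterm : |(Tc k).coef * (((Tt k).fa.isCoord j * (Tt k).fb.val x + (Tt k).fa.val x * (Tt k).fb.isCoord j) -
        ((Tc k).fa.isCoord j * (Tc k).fb.val x' + (Tc k).fa.val x' * (Tc k).fb.isCoord j))| ≤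
        M * (A * (d.2.2.radR + Sb) + (d.2.1.radR + Sa) * B) := by
      rw [hia.1, hia.2, hib.1, hib.2]
      have e1 : (Tc k).coef * ((A * (Tt k).fb.val x + (Tt k).fa.val x * B) - (A * (Tc k).fb.val x' + (Tc k).fa.val x' * B)) =
          (Tc k).coef * (A * ((Tt k).fb.val x - (Tc k).fb.val x') + ((Tt k).fa.val x - (Tc k).fa.val x') * B) := by ring
      rw [e1, abs_mul]
      have hin : |A * ((Tt k).fb.val x - (Tc k).fb.val x') + ((Tt k).fa.val x - (Tc k).fa.val x') * B| ≤
          A * (d.2.2.radR + Sb) + (d.2.1.radR + Sa) * B := by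
        refine (abs_add_le _ _).trans (add_le_add ?_ ?_)
        · rw [abs_mul, abs_of_nonneg hA0]; exact mul_le_mul_of_nonneg_left hdb hA0
        · rw [abs_mul, abs_of_nonneg hB0]; exact mul_le_mul_of_nonneg_right hda hB0
      exact mul_le_mul hqm hin (abs_nonneg _) hM0
    -- the sum over `c` of the new `L` terms
    have hsum : ∑ c, M * (A * d.2.2.icn (e c) + d.2.1.icn (e c) * B) * |x c - x' c| = M * A * Sb + M * B * Sa := by
      have : ∀ c, M * (A * d.2.2.icn (e c) + d.2.1.icn (e c) * B) * |x c - x' c| =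
          M * A * (d.2.2.icn (e c) * |x c - x' c|) + M * B * (d.2.1.icn (e c) * |x c - x' c|) := fun c => by ring
      simp_rw [this]
      rw [Finset.sum_add_distrib, ← Finset.mul_sum, ← Finset.mul_sum]
    rw [List.map_cons, List.sum_cons, Btf_cons]
    simp_rw [Lf_cons, add_mul, Finset.sum_add_distrib]
    rw [hsum]
    refine (abs_add_le _ _).trans ?_
    nlinarith [hterm, ih, hA0, hB0, hM0]

/-- **THE JACOBIAN CLOSENESS OF A ROUGH AND THE CENTRE TERM LIST** (the `hclose` of part XVI, data form): for all
`x, x'`, `|∂_j F_t,i(x) − ∂_j F_c,i(x')| ≤ Bt_ij + Σ_k L_ijk |x_k − x'_k|`. [cite: KapelaZgliczynski2009, §4; cell vocabulary, harvest/h2-tao-ladder rung1/KERNEL-CHEAP-REPLAY-SPEC.md §6 (iv)] -/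
theorem abs_jacEntry_sub_le_Bt_L {rows : ι → List κ} {RD : RRows} (h : IsRTEncl e Tc Tt rows RD)
    (x x' : ι → ℝ) (i j : ι) :
    |jacEntry Tt x i j - jacEntry Tc x' i j| ≤
      Btf (rrow RD (e i)) (e j) + ∑ k, Lf (rrow RD (e i)) (e j) (e k) * |x k - x' k| := by
  obtain ⟨hrows, hsame, hdata⟩ := h
  have hdiff : jacEntry Tt x i j - jacEntry Tc x' i j = ((rows i).map fun k => (Tc k).coef *
      (((Tt k).fa.isCoord j * (Tt k).fb.val x + (Tt k).fa.val x * (Tt k).fb.isCoord j) -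
        ((Tc k).fa.isCoord j * (Tc k).fb.val x' + (Tc k).fa.val x' * (Tc k).fb.isCoord j))).sum := by
    rw [jacEntry, jacEntry, ← Finset.sum_sub_distrib, ← hrows i]
    refine Finset.sum_congr rfl fun k _ => ?_
    rw [coefAt_eq_of_same hsame]; ring
  rw [hdiff]
  exact abs_closeList_le e x x' j (hdata i)

omit [Fintype ι] [DecidableEq ι] [Fintype κ] in
/-- `Bt` and `L` are non-negative on matched data. [folklore] -/
theorem Btf_Lf_nonneg (j c : ℕ) :
    ∀ {dl : List RTermD} {kl : List κ}, List.Forall₂ (fun d k => TermOK e d (Tc k) (Tt k)) dl kl →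
      0 ≤ Btf dl j ∧ 0 ≤ Lf dl j c
  | _, _, List.Forall₂.nil => by simp [Btf, Lf]
  | _, _, List.Forall₂.cons (a := d) (b := k) (l₁ := dl) (l₂ := kl) hd hl => by
    obtain ⟨ih1, ih2⟩ := Btf_Lf_nonneg j c hl
    obtain ⟨-, -, hfa, hfb⟩ := hd
    have ha := radR_nonneg_of_facOK e hfa
    have hb := radR_nonneg_of_facOK e hfb
    have m0 := colVal_magRow_nonneg.mag_toReal_nonneg' d.1
    have a1 := icn_nonneg d.2.1 j
    have a2 := icn_nonneg d.2.2 j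
    have a3 := icn_nonneg d.2.1 c
    have a4 := icn_nonneg d.2.2 c
    rw [Btf_cons, Lf_cons]
    constructor <;> positivity

/-! ### The checker's closeness row -/

omit [DecidableEq ι] [Fintype κ] in
/-- **`Bt + L·prox` IS the sparse closeness row `adRow`.** [cite: KapelaZgliczynski2009, §4; cell vocabulary, harvest/h2-tao-ladder rung1/KERNEL-CHEAP-REPLAY-SPEC.md §6 (iv)] -/
theorem Bt_add_L_prox_eq_colVal_adRow (prox : ℕ → Dyad) (j : ι) :
    ∀ {dl : List RTermD} {kl : List κ}, List.Forall₂ (fun d k => TermOK e d (Tc k) (Tt k)) dl kl →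
      Btf dl (e j) + ∑ k, Lf dl (e j) (e k) * (prox (e k)).toReal = colVal (adRow prox dl) (e j)
  | _, _, List.Forall₂.nil => by simp [Btf, Lf, adRow, colVal]
  | _, _, List.Forall₂.cons (a := d) (b := k) (l₁ := dl) (l₂ := kl) h hl => by
    have ih := Bt_add_L_prox_eq_colVal_adRow prox j hl
    obtain ⟨-, -, hfa, hfb⟩ := h
    -- per-factor: (radD + proxD).toReal = radR + Σ icn prox
    have hfac : ∀ {d' : RFac} {φc φt : Factor ι}, FacOK e d' φc φt →
        (d'.radD.add (d'.proxD prox)).toReal = d'.radR + ∑ c, d'.icn (e c) * (prox (e c)).toReal := by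
      intro d' φc φt h'
      cases d' with
      | coord c =>
        obtain ⟨i, hi, -, -⟩ := h'
        rw [sum_icn_coord e c hi]
        simp [RFac.radD, RFac.proxD, RFac.radR, hi]
      | ext cen rad => rw [sum_icn_ext e]; simp [RFac.radD, RFac.proxD, RFac.radR]
    set M := (IntervalD.mag d.1).toReal with hM
    set A := d.2.1.icn (e j) with hA
    set B := d.2.2.icn (e j) with hB
    set Sa := ∑ c, d.2.1.icn (e c) * (prox (e c)).toReal with hSa
    set Sb := ∑ c, d.2.2.icn (e c) * (prox (e c)).toReal with hSb
    have hsum : ∑ c, M * (A * d.2.2.icn (e c) + d.2.1.icn (e c) * B) * (prox (e c)).toReal = M * A * Sb + M * B * Sa := by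
      have : ∀ c, M * (A * d.2.2.icn (e c) + d.2.1.icn (e c) * B) * (prox (e c)).toReal =
          M * A * (d.2.2.icn (e c) * (prox (e c)).toReal) + M * B * (d.2.1.icn (e c) * (prox (e c)).toReal) :=
        fun c => by ring
      simp_rw [this]
      rw [Finset.sum_add_distrib, ← Finset.mul_sum, ← Finset.mul_sum]
    rw [adRow, colVal_append, colVal_append, colVal_entry, colVal_entry, ← ih, Btf_cons]
    simp_rw [Lf_cons, add_mul, Finset.sum_add_distrib]
    rw [hsum, Dyad.toReal_mul, Dyad.toReal_mul, hfac hfa, hfac hfb]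
    ring

/-! ### Valid indices and sparse products -/

omit [Fintype ι] [DecidableEq ι] in
/-- Entries of a matched factor carry a valid column. [folklore] -/
theorem fst_lt_of_mem_entry {d : RFac} {φc φt : Factor ι} (h : FacOK e d φc φt) (v : Dyad) :
    ∀ p ∈ d.entry v, p.1 < n := by
  cases d with
  | coord c => obtain ⟨i, hi, -, -⟩ := h; intro p hp; simp [RFac.entry] at hp; rw [hp, ← hi]; exact (e i).isLt
  | ext cen rad => simp [RFac.entry]

omit [Fintype ι] [DecidableEq ι] [Fintype κ] in
/-- `magRow` has valid columns on matched data. [folklore] -/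
theorem fst_lt_of_mem_magRow (prec : ℕ) (vb : RFac → IntervalD) :
    ∀ {dl : List RTermD} {kl : List κ}, List.Forall₂ (fun d k => TermOK e d (Tc k) (Tt k)) dl kl →
      ∀ p ∈ magRow prec vb dl, p.1 < n
  | _, _, List.Forall₂.nil => by simp [magRow]
  | _, _, List.Forall₂.cons (a := d) (b := k) h hl => by
    obtain ⟨-, -, hfa, hfb⟩ := h
    intro p hp
    simp only [magRow, List.mem_append] at hp
    rcases hp with (hp | hp) | hp
    · exact fst_lt_of_mem_entry e hfa _ p hp
    · exact fst_lt_of_mem_entry e hfb _ p hp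
    · exact fst_lt_of_mem_magRow prec vb hl p hp

omit [Fintype ι] [DecidableEq ι] [Fintype κ] in
/-- `adRow` has valid columns on matched data. [folklore] -/
theorem fst_lt_of_mem_adRow (prox : ℕ → Dyad) :
    ∀ {dl : List RTermD} {kl : List κ}, List.Forall₂ (fun d k => TermOK e d (Tc k) (Tt k)) dl kl →
      ∀ p ∈ adRow prox dl, p.1 < n
  | _, _, List.Forall₂.nil => by simp [adRow]
  | _, _, List.Forall₂.cons (a := d) (b := k) h hl => by
    obtain ⟨-, -, hfa, hfb⟩ := h
    intro p hp
    simp only [adRow, List.mem_append] at hp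
    rcases hp with (hp | hp) | hp
    · exact fst_lt_of_mem_entry e hfa _ p hp
    · exact fst_lt_of_mem_entry e hfb _ p hp
    · exact fst_lt_of_mem_adRow prox hl p hp

omit [Fintype ι] [DecidableEq ι] [Fintype κ] in
/-- Filtering keeps valid columns. [folklore] -/
theorem fst_lt_of_mem_filter {row : List (ℕ × Dyad)} (h : ∀ p ∈ row, p.1 < n) (P : ℕ × Dyad → Bool) :
    ∀ p ∈ row.filter P, p.1 < n := fun p hp => h p (List.mem_of_mem_filter hp)

omit [DecidableEq ι] in
/-- **Sparse row times column = the real matrix product**: for a row with valid columns,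
`Σ_j colVal row (e j) · g (e j) = Σ_{(c, r) ∈ row} r · g c`. [cite: Neumaier1991, §3.1 Proposition 3.1.2 (6); folklore] -/
theorem sum_colVal_mul (g : ℕ → ℝ) : ∀ {row : List (ℕ × Dyad)}, (∀ p ∈ row, p.1 < n) →
    ∑ j, colVal row (e j) * g (e j) = (row.map fun p => p.2.toReal * g p.1).sum
  | [], _ => by simp [colVal]
  | p :: row, h => by
    classical
    have hp : p.1 < n := h p List.mem_cons_self
    have ih := sum_colVal_mul g (row := row) fun q hq => h q (List.mem_cons_of_mem p hq)
    have hsplit : ∀ j : ι, colVal (p :: row) (e j) = (if p.1 = (e j : ℕ) then p.2.toReal else 0) + colVal row (e j) :=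
      fun j => by simp [colVal]
    simp_rw [hsplit, add_mul]
    rw [Finset.sum_add_distrib, ih, List.map_cons, List.sum_cons]
    congr 1
    rw [Finset.sum_eq_single (e.symm ⟨p.1, hp⟩)]
    · simp
    · intro j _ hj
      rw [if_neg, zero_mul]
      intro h'
      exact hj (by rw [Equiv.eq_symm_apply]; exact Fin.ext h'.symm)
    · simp

omit [Fintype ι] [DecidableEq ι] in
/-- Off-diagonal filtering does not change off-diagonal columns. [folklore] -/
theorem colVal_filter_ne {row : List (ℕ × Dyad)} {c j : ℕ} (hcj : j ≠ c) :
    colVal (row.filter fun p => p.1 ≠ c) j = colVal row j := by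
  induction row with
  | nil => simp [colVal]
  | cons p l ih =>
    by_cases hp : p.1 = c
    · have : ¬ (p.1 ≠ c) := fun h => h hp
      rw [List.filter_cons_of_neg (by simpa using hp)]
      rw [ih]; simp [colVal, hp, hcj.symm]
    · rw [List.filter_cons_of_pos (by simpa using hp)]
      simp only [colVal, List.map_cons, List.sum_cons] at ih ⊢
      rw [ih]

omit [Fintype ι] [DecidableEq ι] in
/-- Filtered magnitude rows stay non-negative. [folklore] -/
theorem colVal_filter_nonneg {row : List (ℕ × Dyad)} (h : ∀ p ∈ row, 0 ≤ p.2.toReal) (P : ℕ × Dyad → Bool) (j : ℕ) :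
    0 ≤ colVal (row.filter P) j := by
  unfold colVal
  refine List.sum_nonneg ?_
  intro x hx
  simp only [List.mem_map] at hx
  obtain ⟨p, hp, rfl⟩ := hx
  split_ifs
  · exact h p (List.mem_of_mem_filter hp)
  · exact le_rfl

omit [Fintype ι] [DecidableEq ι] [Fintype κ] in
/-- Entries of `magRow` are non-negative. [folklore] -/
theorem snd_nonneg_of_mem_magRow (prec : ℕ) (vb : RFac → IntervalD) :
    ∀ (dl : List RTermD), ∀ p ∈ magRow prec vb dl, 0 ≤ p.2.toReal
  | [] => by simp [magRow]
  | d :: dl => by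
    intro p hp
    simp only [magRow, List.mem_append] at hp
    have m0 := colVal_magRow_nonneg.mag_toReal_nonneg'
    rcases hp with (hp | hp) | hp
    · cases h : d.2.1 with
      | coord c => rw [h] at hp; simp [RFac.entry] at hp; rw [hp]; exact m0 _
      | ext cen rad => rw [h] at hp; simp [RFac.entry] at hp
    · cases h : d.2.2 with
      | coord c => rw [h] at hp; simp [RFac.entry] at hp; rw [hp]; exact m0 _
      | ext cen rad => rw [h] at hp; simp [RFac.entry] at hp
    · exact snd_nonneg_of_mem_magRow prec vb dl p hp

end DSSOneShift

end Summit.NavierStokesRegularity.NavierStokesRegularity.Theorems
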